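import Literature.MathematicalPhysics.QuantumLattice.TransferOperatorMinorisation
import HarnessLib

/-!
# Geometric convergence of the transfer operator of a normal MPS tensor

Fourth helper file (after `TransferOperatorPerron.lean`, `TransferOperatorDual.lean`,
`TransferOperatorMinorisation.lean`) towards the discharge of
`Literature.MathematicalPhysics.QuantumLattice.fannes_nachtergaele_werner_decay`
(`LiebRobinson.lean`). Theorems only; no definition, no named fact.

Main result: `IsNormalMPS.exists_transferOp_pow_contraction` — for a normal MPS tensor `A` of
positive bond dimension there are the Perron root `r₀ > 0`, a positive definite right eigenvector
`𝔼(X₀) = r₀ X₀`, the left eigenvector as a functional `φ` (`φ(X₀) = 1`, `φ ∘ 𝔼 = r₀ φ`) and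
constants `C ≥ 0`, `ξ > 0` with

`‖(r₀⁻¹ 𝔼)ⁿ X - φ(X) X₀‖ ≤ C e^{-n/ξ} ‖X‖`  for all `n : ℕ`, `X ∈ M_D(ℂ)`.

This is the "strict contraction" property (5.1) together with Lemma 5.2
(`‖𝔼ⁿ - 𝔼^∞‖ ≤ c λⁿ`) of Fannes–Nachtergaele–Werner (1992) for the (un-normalised) tensor of a
normal MPS; there it is derived from the triviality of the peripheral spectrum via the Jordan
decomposition. Here (Mathlib has neither Perron–Frobenius nor Jordan forms) it is proved by a
Doeblin–Dobrushin oscillation argument in the Loewner order relative to `X₀`: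

* (`TransferOperatorMinorisation`) uniform minorisation `𝔼^ℓ(Z) ≥ δ (Re Tr Z) X₀` for `Z ≥ 0`,
  the Doeblin step/iteration shrinking an enclosure `a X₀ ≤ Y ≤ b X₀` by `(1 - δ Re Tr X₀)` per
  application of `𝔼^ℓ/r₀^ℓ`, persistence of enclosures under `𝔼/r₀`, `θ^(n/ℓ) ≤ 2 e^{-n/ξ}`;
* here: the functional `φ(X) = Tr (Y₀ X) / Tr (Y₀ X₀)` pins the limit (`a ≤ Re φ(H) ≤ b` along
  the iteration), the two-sided bound becomes a norm bound by `norm_le_of_loewner_sandwich`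
  (`TransferOperatorDual`), and a general `X` is split into Hermitian parts.

## Sources

* M. Fannes, B. Nachtergaele, R. F. Werner, *Finitely correlated states on quantum spin chains*,
  Comm. Math. Phys. **144** (1992) 443–490, §5: (5.1) `lim 𝔼ⁿ(B) = 𝔼^∞(B) = Tr(ρB) 𝟙` and
  Lemma 5.2 (`‖𝔼ⁿ - 𝔼^∞‖ ≤ c λⁿ`). [FannesNachtergaeleWernerCMP1992]
* D. Perez-Garcia, F. Verstraete, M. M. Wolf, J. I. Cirac, Quantum Inf. Comput. **7** (2007) 401,
  §3.2 Lemma 4 / Thm. 5 (injective ⇒ primitive transfer operator).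
  [PerezGarciaVerstraeteWolfCiracQIC2007]
* R. L. Dobrushin, *Central limit theorem for nonstationary Markov chains I*, Theory Probab.
  Appl. **1** (1956) 65–80 (oscillation/ergodic-coefficient contraction, classical form).
-/

noncomputable section

open Matrix Filter Topology
open scoped ComplexOrder MatrixOrder Matrix.Norms.L2Operator

namespace Literature.MathematicalPhysics.QuantumLattice

section QLattice

variable {q D : ℕ}

/-! ### The contraction theorem -/

/-- **Geometric convergence of the normalised transfer operator of a normal MPS tensor**
(the "strict contraction" property (5.1) / Lemma 5.2 of Fannes–Nachtergaele–Werner (1992):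
`‖𝔼ⁿ - 𝔼^∞‖ ≤ c λⁿ` with `𝔼^∞(B) = ρ(B) 𝟙` after normalisation). For a normal tensor `A` of
positive bond dimension there are `r₀ > 0` (the Perron root), a positive definite right
eigenvector `𝔼(X₀) = r₀ X₀`, a linear functional `φ` with `φ(X₀) = 1` and `φ ∘ 𝔼 = r₀ φ` (the left
eigenvector `X ↦ Tr (Y₀ X) / Tr (Y₀ X₀)`), and constants `C ≥ 0`, `ξ > 0` such that
`‖(r₀⁻¹ 𝔼)ⁿ X - φ(X) X₀‖ ≤ C e^{-n/ξ} ‖X‖` for all `n` and `X` (L²-operator norm).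
Proof: Perron eigenvectors (`TransferOperatorPerron`, `TransferOperatorDual`), uniform
minorisation of `𝔼^ℓ` (`IsInjectiveMPS.exists_minorisation`), Doeblin/oscillation contraction of
Loewner enclosures `a X₀ ≤ 𝔼^{kℓ} H ≤ b X₀` (`doeblin_iterate`) pinned by `φ`, conversion to a norm
bound (`norm_le_of_loewner_sandwich`) and the Hermitian decomposition `X = H₁ + i H₂`.
[cite: FannesNachtergaeleWernerCMP1992, §5 Lemma 5.2] -/
theorem IsNormalMPS.exists_transferOp_pow_contraction [NeZero D] {A : MPSTensor q D}
    (hA : IsNormalMPS A) :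
    ∃ r₀ : ℝ, 0 < r₀ ∧ ∃ (X₀ : Matrix (Fin D) (Fin D) ℂ) (φ : Matrix (Fin D) (Fin D) ℂ →ₗ[ℂ] ℂ),
      X₀.PosDef ∧ transferOp A X₀ = (r₀ : ℂ) • X₀ ∧ φ X₀ = 1 ∧
      φ ∘ₗ transferOp A = (r₀ : ℂ) • φ ∧
      ∃ C ξ : ℝ, 0 ≤ C ∧ 0 < ξ ∧ ∀ (n : ℕ) (X : Matrix (Fin D) (Fin D) ℂ),
        ‖((((r₀⁻¹ : ℝ) : ℂ) • transferOp A) ^ n) X - φ X • X₀‖ ≤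
          C * Real.exp (-((n : ℝ) / ξ)) * ‖X‖ := by
  obtain ⟨ℓ, hℓ, hinj⟩ := hA
  obtain ⟨r₀, hr₀, X₀, hX₀, hTX₀⟩ := hinj.exists_posDef_eigenvector hℓ
  obtain ⟨Y₀, hY₀, hTY₀⟩ := hinj.exists_posDef_left_eigenvector hℓ hX₀ hTX₀
  have hX₀0 : X₀ ≠ 0 := by
    intro h0
    have := hX₀.trace_pos
    rw [h0, trace_zero] at this
    exact lt_irrefl _ this
  -- the left eigenvector as a functional `φ X = Tr (Y₀ X) / Tr (Y₀ X₀)`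
  set c : ℝ := ((Y₀ * X₀).trace).re with hc_def
  have hc : 0 < c := re_trace_mul_pos hY₀ hX₀.posSemidef hX₀0
  have hc' : (Y₀ * X₀).trace = (c : ℂ) :=
    Complex.ext rfl (by rw [Complex.ofReal_im]; exact im_trace_mul_of_isHermitian hY₀.1 hX₀.1)
  set φ : Matrix (Fin D) (Fin D) ℂ →ₗ[ℂ] ℂ :=
    ((c⁻¹ : ℝ) : ℂ) • (Matrix.traceLinearMap (Fin D) ℂ ℂ ∘ₗ LinearMap.mulLeft ℂ Y₀) with hφ_def
  have hφ_apply : ∀ X, φ X = ((c⁻¹ : ℝ) : ℂ) * (Y₀ * X).trace := fun X => rfl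
  have hφX₀ : φ X₀ = 1 := by
    rw [hφ_apply, hc', ← Complex.ofReal_mul, inv_mul_cancel₀ hc.ne', Complex.ofReal_one]
  have hφE : ∀ X, φ (transferOp A X) = (r₀ : ℂ) * φ X := by
    intro X
    rw [hφ_apply, hφ_apply, trace_mul_transferOp, hTY₀, Matrix.smul_mul, trace_smul, smul_eq_mul]
    ring
  have hφpos : ∀ Z : Matrix (Fin D) (Fin D) ℂ, Z.PosSemidef → 0 ≤ (φ Z).re := by
    intro Z hZ
    rw [hφ_apply, Complex.re_ofReal_mul]
    exact mul_nonneg (inv_nonneg.mpr hc.le) (re_trace_mul_nonneg hY₀.posSemidef hZ)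
  have hφreal : ∀ H : Matrix (Fin D) (Fin D) ℂ, H.IsHermitian → (φ H).im = 0 := by
    intro H hH
    rw [hφ_apply, Complex.im_ofReal_mul, im_trace_mul_of_isHermitian hY₀.1 hH, mul_zero]
  -- the normalised map `T = r₀⁻¹ 𝔼`
  set T : Matrix (Fin D) (Fin D) ℂ →ₗ[ℂ] Matrix (Fin D) (Fin D) ℂ :=
    ((r₀⁻¹ : ℝ) : ℂ) • transferOp A with hT_def
  have hT_apply : ∀ X, T X = ((r₀⁻¹ : ℝ) : ℂ) • transferOp A X := fun X => rfl
  have hTX₀' : T X₀ = X₀ := by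
    rw [hT_apply, hTX₀, smul_smul, ← Complex.ofReal_mul, inv_mul_cancel₀ hr₀.ne',
      Complex.ofReal_one, one_smul]
  have hTpos : ∀ Z : Matrix (Fin D) (Fin D) ℂ, Z.PosSemidef → (T Z).PosSemidef := fun Z hZ => by
    rw [hT_apply]
    exact (transferOp_posSemidef A hZ).smul (Complex.zero_le_real.mpr (inv_nonneg.mpr hr₀.le))
  have hφT : ∀ X, φ (T X) = φ X := by
    intro X
    rw [hT_apply, map_smul, hφE, smul_eq_mul, ← mul_assoc, ← Complex.ofReal_mul,
      inv_mul_cancel₀ hr₀.ne', Complex.ofReal_one, one_mul]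
  have hφTn : ∀ (n : ℕ) X, φ ((T ^ n) X) = φ X := by
    intro n
    induction n with
    | zero => intro X; rfl
    | succ n ih => intro X; rw [pow_succ', Module.End.mul_apply, hφT, ih]
  have hTpow : ∀ (n : ℕ) X, (T ^ n) X = (((r₀⁻¹ : ℝ) : ℂ) ^ n) • (transferOp A ^ n) X := by
    intro n X
    rw [hT_def, smul_pow]
    rfl
  -- minorisation for `T^ℓ`
  obtain ⟨δ, hδ, hmin⟩ := hinj.exists_minorisation hX₀
  set δ' : ℝ := r₀⁻¹ ^ ℓ * δ with hδ'
  have hδ'pos : 0 < δ' := mul_pos (pow_pos (inv_pos.mpr hr₀) ℓ) hδ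
  have hmin' : ∀ Z : Matrix (Fin D) (Fin D) ℂ, Z.PosSemidef →
      ((T ^ ℓ) Z - ((δ' * Z.trace.re : ℝ) : ℂ) • X₀).PosSemidef := by
    intro Z hZ
    have h1 := (hmin Z hZ).smul (Complex.zero_le_real.mpr (pow_nonneg (inv_nonneg.mpr hr₀.le) ℓ))
    rw [smul_sub, smul_smul, ← Complex.ofReal_mul] at h1
    convert h1 using 2
    · rw [hTpow, Complex.ofReal_pow]
    · rw [hδ', mul_assoc]
  have hTℓX₀ : (T ^ ℓ) X₀ = X₀ := pow_apply_of_apply_eq T hTX₀' ℓ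
  -- the contraction factor `θ₀ = 1 - δ' Re Tr X₀ ∈ [0, 1)`
  set τ₀ : ℝ := X₀.trace.re with hτ₀_def
  have hτ₀ : 0 < τ₀ := (Complex.pos_iff.mp hX₀.trace_pos).1
  set θ₀ : ℝ := 1 - δ' * τ₀ with hθ₀_def
  have hθ₀0 : 0 ≤ θ₀ := by
    have h1 := hmin' X₀ hX₀.posSemidef
    rw [hTℓX₀] at h1
    have h2 := (Complex.nonneg_iff.mp h1.trace_nonneg).1
    rw [trace_sub, trace_smul, smul_eq_mul, Complex.sub_re, Complex.re_ofReal_mul] at h2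
    by_contra hneg
    push Not at hneg
    have : θ₀ * τ₀ < 0 := mul_neg_of_neg_of_pos hneg hτ₀
    rw [hθ₀_def] at this
    nlinarith
  have hθ₀1 : θ₀ < 1 := by
    rw [hθ₀_def]
    linarith [mul_pos hδ'pos hτ₀]
  -- `X₀ ≥ λ 1`
  obtain ⟨lam, hlam, hXlam⟩ := exists_pos_sub_smul_posSemidef hX₀ isHermitian_one
  -- the Hermitian case
  have herm_case : ∀ (n : ℕ) (H : Matrix (Fin D) (Fin D) ℂ), H.IsHermitian →
      ‖(T ^ n) H - φ H • X₀‖ ≤ θ₀ ^ (n / ℓ) * (2 * (‖H‖ / lam)) * ‖X₀‖ := by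
    intro n H hH
    set b : ℝ := ‖H‖ / lam with hb_def
    have hb0 : 0 ≤ b := div_nonneg (norm_nonneg _) hlam.le
    have hbl : (b : ℂ) * (lam : ℂ) = (‖H‖ : ℂ) := by
      rw [← Complex.ofReal_mul, hb_def, div_mul_cancel₀ _ hlam.ne']
    have hencl_b : ((b : ℂ) • X₀ - H).PosSemidef := by
      have e1 := (hXlam.smul (Complex.zero_le_real.mpr hb0)).add (posSemidef_norm_smul_one_sub hH)
      convert e1 using 1
      rw [smul_sub, smul_smul, hbl]
      abel
    have hencl_a : (H - ((-b : ℝ) : ℂ) • X₀).PosSemidef := by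
      have e2 := (hXlam.smul (Complex.zero_le_real.mpr hb0)).add (posSemidef_norm_smul_one_add hH)
      convert e2 using 1
      push_cast
      rw [smul_sub, smul_smul, hbl, neg_smul, sub_neg_eq_add]
      abel
    -- `T^n = (T^ℓ)^(n/ℓ) ∘ T^(n%ℓ)`
    have hTn : (T ^ n) H = ((T ^ ℓ) ^ (n / ℓ)) ((T ^ (n % ℓ)) H) := by
      conv_lhs => rw [← Nat.div_add_mod n ℓ, pow_add, pow_mul, Module.End.mul_apply]
    obtain ⟨hja, hjb⟩ := enclosure_pow_of_posSemidef T hTpos hTX₀' hencl_a hencl_b (n % ℓ)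
    obtain ⟨a', b', ha', hb', hw⟩ := doeblin_iterate (T ^ ℓ) hmin' hTℓX₀ (n / ℓ) hja hjb
    set Y := ((T ^ ℓ) ^ (n / ℓ)) ((T ^ (n % ℓ)) H) with hY_def
    have hφY : φ Y = φ H := by rw [← hTn, hφTn]
    set r : ℝ := (φ H).re with hr_def
    have hφH : φ H = (r : ℂ) := Complex.ext rfl (by rw [Complex.ofReal_im]; exact hφreal H hH)
    have har : a' ≤ r := by
      have h1 := hφpos _ ha'
      rwa [map_sub, map_smul, hφY, hφX₀, hφH, smul_eq_mul, mul_one, ← Complex.ofReal_sub,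
        Complex.ofReal_re, sub_nonneg] at h1
    have hrb : r ≤ b' := by
      have h1 := hφpos _ hb'
      rwa [map_sub, map_smul, hφY, hφX₀, hφH, smul_eq_mul, mul_one, ← Complex.ofReal_sub,
        Complex.ofReal_re, sub_nonneg] at h1
    have hYherm : Y.IsHermitian := by
      have e : Y = (Y - (a' : ℂ) • X₀) + (a' : ℂ) • X₀ := by abel
      rw [e]
      exact ha'.1.add (isHermitian_real_smul hX₀.1 a')
    have hE : (Y - φ H • X₀).IsHermitian := by
      rw [hφH]
      exact hYherm.sub (isHermitian_real_smul hX₀.1 r)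
    have hw0 : 0 ≤ b' - a' := by linarith
    have h₁ : (((b' - a' : ℝ) : ℂ) • X₀ - (Y - φ H • X₀)).PosSemidef := by
      have e1 := hb'.add (hX₀.posSemidef.smul (Complex.zero_le_real.mpr (sub_nonneg.mpr har)))
      convert e1 using 1
      rw [hφH]
      push_cast
      module
    have h₂ : (((b' - a' : ℝ) : ℂ) • X₀ + (Y - φ H • X₀)).PosSemidef := by
      have e2 := ha'.add (hX₀.posSemidef.smul (Complex.zero_le_real.mpr (sub_nonneg.mpr hrb)))
      convert e2 using 1
      rw [hφH]
      push_cast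
      module
    have hnorm := norm_le_of_loewner_sandwich hE hX₀.posSemidef hw0 h₁ h₂
    rw [hTn]
    calc ‖Y - φ H • X₀‖ ≤ (b' - a') * ‖X₀‖ := hnorm
      _ = θ₀ ^ (n / ℓ) * (2 * (‖H‖ / lam)) * ‖X₀‖ := by
          rw [hw, hθ₀_def, hτ₀_def, hb_def]
          ring
  -- constants
  set ξ : ℝ := -(ℓ : ℝ) / Real.log (max θ₀ 2⁻¹) with hξ_def
  have hξ : 0 < ξ := by
    have hlog : Real.log (max θ₀ 2⁻¹) < 0 :=
      Real.log_neg (lt_max_of_lt_right (by norm_num)) (max_lt hθ₀1 (by norm_num))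
    rw [hξ_def]
    exact div_pos_of_neg_of_neg (by simpa using hℓ) hlog
  have hexp : ∀ n : ℕ, θ₀ ^ (n / ℓ) ≤ 2 * Real.exp (-((n : ℝ) / ξ)) := fun n =>
    pow_div_le_two_mul_exp hθ₀0 hθ₀1 hℓ n
  have hB : ∀ (n : ℕ) (H : Matrix (Fin D) (Fin D) ℂ), H.IsHermitian →
      ‖(T ^ n) H - φ H • X₀‖ ≤ (4 * ‖X₀‖ / lam) * Real.exp (-((n : ℝ) / ξ)) * ‖H‖ := by
    intro n H hH
    refine (herm_case n H hH).trans ?_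
    have h1 := hexp n
    have h2 : 0 ≤ 2 * (‖H‖ / lam) * ‖X₀‖ := by positivity
    calc θ₀ ^ (n / ℓ) * (2 * (‖H‖ / lam)) * ‖X₀‖
        = θ₀ ^ (n / ℓ) * (2 * (‖H‖ / lam) * ‖X₀‖) := by ring
      _ ≤ (2 * Real.exp (-((n : ℝ) / ξ))) * (2 * (‖H‖ / lam) * ‖X₀‖) :=
          mul_le_mul_of_nonneg_right h1 h2
      _ = (4 * ‖X₀‖ / lam) * Real.exp (-((n : ℝ) / ξ)) * ‖H‖ := by
          field_simp
          ring
  refine ⟨r₀, hr₀, X₀, φ, hX₀, hTX₀, hφX₀, ?_, 8 * ‖X₀‖ / lam, ξ, by positivity, hξ, fun n X => ?_⟩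
  · ext X
    simp only [LinearMap.comp_apply, LinearMap.smul_apply, smul_eq_mul, hφE]
  -- general `X = H₁ + i H₂`
  set H₁ : Matrix (Fin D) (Fin D) ℂ := ((2⁻¹ : ℝ) : ℂ) • (X + Xᴴ) with hH₁_def
  set H₂ : Matrix (Fin D) (Fin D) ℂ := ((2⁻¹ : ℝ) : ℂ) • (Complex.I • (Xᴴ - X)) with hH₂_def
  have hH₁ : H₁.IsHermitian := by
    refine isHermitian_real_smul ?_ _
    unfold Matrix.IsHermitian
    rw [conjTranspose_add, conjTranspose_conjTranspose, add_comm]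
  have hH₂ : H₂.IsHermitian := by
    refine isHermitian_real_smul ?_ _
    unfold Matrix.IsHermitian
    rw [conjTranspose_smul, conjTranspose_sub, conjTranspose_conjTranspose, Complex.star_def,
      Complex.conj_I, neg_smul, ← smul_neg, neg_sub]
  have hX : X = H₁ + Complex.I • H₂ := by
    simp only [hH₁_def, hH₂_def]
    rw [smul_comm Complex.I, smul_smul Complex.I Complex.I, Complex.I_mul_I]
    push_cast
    module
  have hn₁ : ‖H₁‖ ≤ ‖X‖ := by
    rw [hH₁_def, norm_smul]
    calc ‖((2⁻¹ : ℝ) : ℂ)‖ * ‖X + Xᴴ‖ ≤ ‖((2⁻¹ : ℝ) : ℂ)‖ * (‖X‖ + ‖Xᴴ‖) := by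
          gcongr; exact norm_add_le _ _
      _ = ‖X‖ := by rw [l2_opNorm_conjTranspose]; simp; ring
  have hn₂ : ‖H₂‖ ≤ ‖X‖ := by
    rw [hH₂_def, norm_smul, norm_smul, Complex.norm_I, one_mul]
    calc ‖((2⁻¹ : ℝ) : ℂ)‖ * ‖Xᴴ - X‖ ≤ ‖((2⁻¹ : ℝ) : ℂ)‖ * (‖Xᴴ‖ + ‖X‖) := by
          gcongr; exact norm_sub_le _ _
      _ = ‖X‖ := by rw [l2_opNorm_conjTranspose]; simp; ring
  clear_value H₁ H₂
  have hdecomp : (T ^ n) X - φ X • X₀ =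
      ((T ^ n) H₁ - φ H₁ • X₀) + Complex.I • ((T ^ n) H₂ - φ H₂ • X₀) := by
    rw [hX, map_add, map_smul, map_add, map_smul, smul_eq_mul]
    module
  rw [hdecomp]
  calc ‖((T ^ n) H₁ - φ H₁ • X₀) + Complex.I • ((T ^ n) H₂ - φ H₂ • X₀)‖
      ≤ ‖(T ^ n) H₁ - φ H₁ • X₀‖ + ‖Complex.I • ((T ^ n) H₂ - φ H₂ • X₀)‖ := norm_add_le _ _
    _ = ‖(T ^ n) H₁ - φ H₁ • X₀‖ + ‖(T ^ n) H₂ - φ H₂ • X₀‖ := by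
        rw [norm_smul, Complex.norm_I, one_mul]
    _ ≤ (4 * ‖X₀‖ / lam) * Real.exp (-((n : ℝ) / ξ)) * ‖H₁‖ +
        (4 * ‖X₀‖ / lam) * Real.exp (-((n : ℝ) / ξ)) * ‖H₂‖ :=
        add_le_add (hB n H₁ hH₁) (hB n H₂ hH₂)
    _ ≤ (4 * ‖X₀‖ / lam) * Real.exp (-((n : ℝ) / ξ)) * ‖X‖ +
        (4 * ‖X₀‖ / lam) * Real.exp (-((n : ℝ) / ξ)) * ‖X‖ := by
        gcongr
    _ = 8 * ‖X₀‖ / lam * Real.exp (-((n : ℝ) / ξ)) * ‖X‖ := by ring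

end QLattice

end Literature.MathematicalPhysics.QuantumLattice
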